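import Literature.Computability.Complexity.OccurrenceObstructionsDischarge
import Literature.Computability.AlgebraicComplexity.CoordRepRational
import Literature.NumberTheory.DiophantineGeometry.GLHighestWeightExistsUniqueProofs
import Literature.NumberTheory.DiophantineGeometry.SchurWeylPlethysmOrbitWeightsProofs
import HarnessLib

/-!
# No occurrence obstructions in MODULE form: discharge of `bip2019_not_hasOccurrenceObstruction`
# (Bürgisser–Ikenmeyer–Panova, J. AMS 32 (2019), Thm. 1.4)

Topic `Literature/Computability/Complexity`; sibling proofs file of `OccurrenceObstructionsBIP.lean`
(D-0014); theorems only, no definitions, no statement of the tree is changed.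

`OccurrenceObstructionsBIP.lean` states BIP's Thm. 1.4 ("Let `n, d, m` be positive integers with
`n ≥ m^25` and `λ ⊢ nd`. If `λ` occurs in `ℂ[Z_{n,m}]`, then `λ` also occurs in `ℂ[Ω_n]`. In
particular, Conjecture 1.3 is false.") for BIP's own padded permanent in two renderings: the WEIGHT
form `bip2019_no_occurrence_obstructions` (every highest weight of `GL_{m²}` occurring in `ℂ[Z]`
occurs in `ℂ[Ω_m]`), proved in the tree as `bip2019_no_occurrence_obstructions_holds`
(`OccurrenceObstructionsDischarge.lean`), and the MODULE form `bip2019_not_hasOccurrenceObstruction`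
in the language of `GCTObstructions.lean` (`HasOccurrenceObstruction f g m d`: some irreducible
subrepresentation `W ⊆ ℂ[Δ[g]]_d` admits no nonzero intertwiner to `ℂ[Δ[f]]_d`), whose "link to the
weight form needs complete reducibility of rational `GL_N(ℂ)`-modules" (module docstring of
`OccurrenceObstructionsDischarge.lean`). This file supplies that link and proves the module form:

* `weightSpace_orbitCoordRep_le_orbitCoordRingDeg`, `size_eq_of_mem_weightSpace_of_mem_orbitCoordRingDeg`
  — a weight pins the degree in `k[Δ_m[f]]` (BLMW 2011 §5.2): a torus weight vector of weight `χ`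
  lies in the single degree piece `D = -|χ|/m`, and a nonzero one in the degree-`d` piece has
  `|χ| = -m d`;
* `not_hasOccurrenceObstruction_of_forall_hasHighestWeight` — over an algebraically closed field of
  characteristic zero and for `m ≠ 0`: if every highest weight of `k[Δ_m[g]]` occurs in `k[Δ_m[f]]`,
  there is no occurrence obstruction against `g ∈ Δ[f]` in any degree (existence of a highest-weight
  vector in the irreducible `W`, `exists_hasHighestWeight_of_finiteDimensional_holds`; rationality of
  the coordinate rings, `CoordRepRational.lean`; pinning; and the extension of a highest-weight
  vector to an intertwiner, `exists_intertwiningMap_apply_eq`, which rests on complete reducibility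
  and the theorem of the highest weight);
* `hasOccurrenceObstruction_rename_toLex_iff` — the predicate is unchanged by passing from the
  matrix variables `Fin m × Fin m` to their lexicographically ordered copy `MatIdx m`;
* `bip2019_not_hasOccurrenceObstruction_holds : bip2019_not_hasOccurrenceObstruction` — BIP Thm. 1.4
  in module form, unconditionally (trust base: the axiom whitelist).

## References

* P. Bürgisser, C. Ikenmeyer, G. Panova, *No occurrence obstructions in geometric complexity
  theory*, J. AMS 32 (2019) 163–193 = arXiv:1604.06431v3: §1.1 (occurrence of `λ`, Schur's lemma,
  Conj. 1.3), Thm. 1.4; held text arXiv:1604.06431 p. 3 ("We say that `λ` occurs in `ℂ[Ω_n]` if it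
  contains the dual of an irreducible `G`-module of type `λ`"; "Schur's lemma implies that if `λ`
  occurs in `ℂ[Z_{n,m}]`, then it must also occur in `ℂ[Ω_n]`") and p. 4 (Theorem 4 = v3 Thm. 1.4:
  "In particular, Conjecture (conj:occ-obstr) is false."). [BurgisserIkenmeyerPanovaJAMS2019]
* P. Bürgisser, J. M. Landsberg, L. Manivel, J. Weyman, SIAM J. Comput. 40 (2011), §4.4, §5.2
  (weights and degrees of coordinate rings). [BurgisserEtAl2011]

## Tree

`bip2019_no_occurrence_obstructions_holds` (`OccurrenceObstructionsDischarge`), `isRationalRep_orbitCoordRep`,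
`isRationalRep_orbitCoordRepDeg` (`CoordRepRational`), `exists_hasHighestWeight_of_finiteDimensional_holds`
(`GLHighestWeightExistsUniqueProofs`), `exists_intertwiningMap_apply_eq`, `IsRationalRep.toRepresentation`,
`mem_highestWeightSpace_toRepresentation_iff` (`GLHighestWeightMultiplicityProofs`),
`sum_filter_monWeight_mem_orbitVanishingIdeal` (`SchurWeylPlethysmOrbitWeightsProofs`),
`size_monWeight`, `monWeight` (`OrbitClosureWeights`), `finite_homogeneousSubmodule`
(`MultiplicityObstructionsProofs`), `HasOccurrenceObstruction`, `orbitCoordRingDeg`, `orbitCoordSubrep`,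
`orbitCoordRepDeg` (`GCTObstructions`).
-/

noncomputable section

open scoped BigOperators

namespace Literature.Computability.Complexity

open MvPolynomial Literature.NumberTheory.DiophantineGeometry Literature.Computability.AlgebraicComplexity

/-! ### A weight pins the degree in `k[Δ_m[f]]` -/

section Pinning

variable {σ : Type*} [Fintype σ] [LinearOrder σ] {k : Type*} [Field k]

/-- The torus relation of a weight vector modulo the vanishing ideal of the orbit, on
representatives: if `[F]` is a weight vector of weight `χ` of `k[Δ_m[f]]`, then
`t · F - χ(t) F ∈ I(GL · f)` for every diagonal `t`. [folklore] -/
theorem coordSubst_sub_smul_mem_of_mem_weightSpace (f : MvPolynomial σ k) {m : ℕ} {χ : Weight σ}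
    {F : MvPolynomial (DegIdx σ m) k}
    (hF : Ideal.Quotient.mk (orbitVanishingIdeal f m) F ∈ weightSpace (orbitCoordRep f m) χ)
    {t : GL σ k} (ht : IsDiagonalGL t) :
    coordSubst m t F - weightChar χ t • F ∈ orbitVanishingIdeal f m := by
  rw [← Ideal.Quotient.eq]
  have h := hF t ht
  rw [orbitCoordRep_apply, orbitCoordSubst_mk] at h
  rw [h]
  exact (map_smul (Ideal.Quotient.mkₐ k (orbitVanishingIdeal f m)) (weightChar χ t) F).symm

/-- **A weight pins the degree (size of the weight).** Over an infinite field, a nonzero torus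
weight vector of weight `χ` lying in the degree-`d` piece `k[Δ_m[f]]_d` has `|χ| = -m d`: some
monomial of a degree-`d` representative has torus weight `χ` (the parts of the other weights lie in
the vanishing ideal, `sum_filter_monWeight_mem_orbitVanishingIdeal`), and a monomial of degree `d`
in the coordinates of `Sym^m` has weight of size `-m d` (`size_monWeight`). BLMW 2011 §4.4, §5.2
(the centre acts on `ℂ[Sym^m V]_d` by the degree). [cite: BurgisserEtAl2011, §5.2] -/
theorem size_eq_of_mem_weightSpace_of_mem_orbitCoordRingDeg [Infinite k] (f : MvPolynomial σ k)
    {m d : ℕ} {χ : Weight σ} {x : OrbitCoordRing f m}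
    (hx : x ∈ weightSpace (orbitCoordRep f m) χ) (hxd : x ∈ orbitCoordRingDeg f m d)
    (hx0 : x ≠ 0) : χ.size = -((m * d : ℕ) : ℤ) := by
  classical
  obtain ⟨G, hG, rfl⟩ := mem_orbitCoordRingDeg_iff.1 hxd
  by_contra hne
  apply hx0
  rw [Ideal.Quotient.eq_zero_iff_mem]
  -- no monomial of `G` has weight `χ`
  have hsne : ∀ s ∈ G.support, monWeight s ≠ χ := by
    intro s hs h
    apply hne
    have hdeg : s.degree = d := by
      rw [Finsupp.degree_apply]
      exact (hG.degree_eq_sum_deg_support hs).symm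
    rw [← h, size_monWeight, hdeg]
  -- split `G` into its torus-weight parts, each in the ideal
  set W : Finset (Weight σ) := G.support.image monWeight with hW
  have hmaps : ∀ s ∈ G.support, monWeight s ∈ W := fun s hs => Finset.mem_image_of_mem _ hs
  have hGsum : G = ∑ v ∈ W, ∑ s ∈ G.support.filter (fun s => monWeight s = v),
      monomial s (coeff s G) := by
    conv_lhs => rw [← G.support_sum_monomial_coeff]
    exact (Finset.sum_fiberwise_of_maps_to hmaps _).symm
  rw [hGsum]
  refine Ideal.sum_mem _ fun v hv => ?_
  obtain ⟨s, hs, rfl⟩ := Finset.mem_image.mp hv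
  exact sum_filter_monWeight_mem_orbitVanishingIdeal f
    (fun t ht => coordSubst_sub_smul_mem_of_mem_weightSpace f hx ht) (hsne s hs)

/-- **A weight pins the degree (the piece).** Over an infinite field and for `m ≠ 0`, every torus
weight vector of weight `χ` of `k[Δ_m[f]]` lies in the single degree piece `k[Δ_m[f]]_D`,
`D = (-|χ|) / m`: its representative is congruent modulo `I(GL · f)` to its part of torus weight
`χ`, a form of degree `D` (the argument of `finiteDimensional_highestWeightSpace_orbitCoordRep_holds`,
sharpened from "total degree `≤ D`" to "homogeneous of degree `D`"). BLMW 2011 §5.2.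
[cite: BurgisserEtAl2011, §5.2] -/
theorem weightSpace_orbitCoordRep_le_orbitCoordRingDeg [Infinite k] (f : MvPolynomial σ k) {m : ℕ}
    (hm : m ≠ 0) (χ : Weight σ) :
    weightSpace (orbitCoordRep f m) χ ≤ orbitCoordRingDeg f m ((-χ.size).toNat / m) := by
  classical
  intro x hx
  obtain ⟨F, rfl⟩ := Ideal.Quotient.mk_surjective x
  set D := (-χ.size).toNat / m with hD
  -- the part of weight `χ`
  set Fχ : MvPolynomial (DegIdx σ m) k :=
    ∑ s ∈ F.support.filter (fun s => monWeight s = χ), monomial s (coeff s F) with hFχ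
  have hdiff : F - Fχ ∈ orbitVanishingIdeal f m := by
    set W : Finset (Weight σ) := insert χ (F.support.image monWeight) with hW
    have hmaps : ∀ s ∈ F.support, monWeight s ∈ W := fun s hs =>
      Finset.mem_insert_of_mem (Finset.mem_image_of_mem _ hs)
    have hFsum : F = ∑ v ∈ W, ∑ s ∈ F.support.filter (fun s => monWeight s = v),
        monomial s (coeff s F) := by
      conv_lhs => rw [← F.support_sum_monomial_coeff]
      exact (Finset.sum_fiberwise_of_maps_to hmaps _).symm
    have hsplit : F - Fχ = ∑ v ∈ W.erase χ, ∑ s ∈ F.support.filter (fun s => monWeight s = v),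
        monomial s (coeff s F) := by
      rw [sub_eq_iff_eq_add, hFχ, Finset.sum_erase_add _ _ (Finset.mem_insert_self χ _), ← hFsum]
    rw [hsplit]
    exact Ideal.sum_mem _ fun v hv =>
      sum_filter_monWeight_mem_orbitVanishingIdeal f
        (fun t ht => coordSubst_sub_smul_mem_of_mem_weightSpace f hx ht) (Finset.ne_of_mem_erase hv)
  have hhom : Fχ.IsHomogeneous D := by
    rw [hFχ]
    refine IsHomogeneous.sum _ _ _ fun s hs => isHomogeneous_monomial _ ?_
    have hw := (Finset.mem_filter.mp hs).2
    have hsize := size_monWeight s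
    rw [hw] at hsize
    have h1 : (-χ.size).toNat = m * s.degree := by rw [hsize, neg_neg, Int.toNat_natCast]
    rw [hD, h1, Nat.mul_div_cancel_left _ (Nat.pos_of_ne_zero hm)]
  refine mem_orbitCoordRingDeg_iff.2 ⟨Fχ, hhom, ?_⟩
  rw [Ideal.Quotient.eq]
  have : Fχ - F = -(F - Fχ) := by ring
  rw [this]
  exact Submodule.neg_mem _ hdiff

end Pinning

/-! ### Weight form implies module form -/

section Bridge

variable {σ : Type*} [Fintype σ] [LinearOrder σ] {k : Type*} [Field k]

/-- An irreducible representation is carried by a nontrivial space (its lattice of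
subrepresentations has `⊥ ≠ ⊤`). [folklore] -/
theorem nontrivial_of_isIrreducible {G V : Type*} [Monoid G] [AddCommGroup V] [Module k V]
    {ρ : Representation k G V} (h : ρ.IsIrreducible) : Nontrivial V := by
  by_contra hV
  haveI : Subsingleton V := not_nontrivial_iff_subsingleton.mp hV
  haveI : Subsingleton (Submodule k V) := (Submodule.subsingleton_iff k).mpr inferInstance
  obtain ⟨U₁, U₂, hU⟩ := h.toNontrivial
  exact hU (Subrepresentation.toSubmodule_injective (Subsingleton.elim _ _))

/-- **No occurrence obstruction from no missing weight (weight form ⇒ module form).** Let `k` be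
algebraically closed of characteristic zero, `f, g` forms in the variables `σ`, `m ≠ 0`. If every
highest weight occurring in `k[Δ_m[g]]` occurs in `k[Δ_m[f]]`, then there is no occurrence
obstruction against `g ∈ Δ[f]` in any degree `d` (`HasOccurrenceObstruction`, `GCTObstructions.lean`):
an irreducible `W ⊆ k[Δ_m[g]]_d` is finite-dimensional and rational (`isRationalRep_orbitCoordRep`),
so it has a highest-weight vector `w` of some weight `χ` (Lie–Kolchin,
`exists_hasHighestWeight_of_finiteDimensional_holds`), with `|χ| = -m d` (a weight pins the
degree); by hypothesis `χ` occurs in `k[Δ_m[f]]`, by pinning inside `k[Δ_m[f]]_d`, and a nonzero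
highest-weight vector `v ∈ k[Δ_m[f]]_d` of weight `χ` is `F(w)` for an intertwiner `F : W → k[Δ_m[f]]_d`
(`exists_intertwiningMap_apply_eq`: complete reducibility and the theorem of the highest weight),
which is therefore nonzero. This is the equivalence "`λ` occurs ⇔ `mult_λ > 0` ⇔ a copy of `V_λ`
embeds" used throughout BIP §1 ("Schur's lemma implies that if `λ` occurs in `ℂ[Z_{n,m}]`, then it
must also occur in `ℂ[Ω_n]`"). [cite: BurgisserIkenmeyerPanovaJAMS2019, §1.1 (occurrence obstructions, Schur's lemma)] -/
theorem not_hasOccurrenceObstruction_of_forall_hasHighestWeight [IsAlgClosed k] [CharZero k]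
    {f g : MvPolynomial σ k} {m : ℕ} (hm : m ≠ 0) (d : ℕ)
    (H : ∀ χ : Weight σ, HasHighestWeight (orbitCoordRep g m) χ →
      HasHighestWeight (orbitCoordRep f m) χ) :
    ¬ HasOccurrenceObstruction f g m d := by
  rintro ⟨W, hWd, hirr, hψ⟩
  -- finite-dimensionality of the degree pieces and of `W`
  haveI : Module.Finite k (homogeneousSubmodule (DegIdx σ m) k d) := finite_homogeneousSubmodule _ _ _
  haveI hfg : Module.Finite k (orbitCoordRingDeg g m d) := Module.Finite.map _ _
  haveI hff : Module.Finite k (orbitCoordRingDeg f m d) := Module.Finite.map _ _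
  haveI : Module.Finite k W.toSubmodule := Submodule.finiteDimensional_of_le hWd
  -- rationality
  have hWrat : IsRationalRep W.toRepresentation := (isRationalRep_orbitCoordRep g m).toRepresentation W
  have hfrat : IsRationalRep (orbitCoordRepDeg f m d) := isRationalRep_orbitCoordRepDeg f m d
  -- a highest-weight vector of `W`
  haveI : W.toRepresentation.IsIrreducible := hirr
  haveI : Nontrivial W.toSubmodule := nontrivial_of_isIrreducible hirr
  obtain ⟨χ, hχ⟩ := exists_hasHighestWeight_of_finiteDimensional_holds W.toRepresentation hWrat
  obtain ⟨w, hw0, hw⟩ := (hasHighestWeight_iff_exists _ _).mp hχ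
  have hw' : (w : OrbitCoordRing g m) ∈ highestWeightSpace (orbitCoordRep g m) χ :=
    (mem_highestWeightSpace_toRepresentation_iff W χ w).mp hw
  have hw0' : (w : OrbitCoordRing g m) ≠ 0 := fun h => hw0 (Subtype.ext h)
  -- the weight pins the degree: `|χ| = -m d`
  have hsize : χ.size = -((m * d : ℕ) : ℤ) :=
    size_eq_of_mem_weightSpace_of_mem_orbitCoordRingDeg g
      (highestWeightSpace_le_weightSpace _ _ hw') (hWd w.2) hw0'
  -- `χ` occurs in `k[Δ_m[f]]`, inside the degree-`d` piece
  obtain ⟨v, hv0, hv⟩ := (hasHighestWeight_iff_exists _ _).mp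
    (H χ ((hasHighestWeight_iff_exists _ _).mpr ⟨_, hw0', hw'⟩))
  have hvd : v ∈ orbitCoordRingDeg f m d := by
    have h := weightSpace_orbitCoordRep_le_orbitCoordRingDeg f hm χ
      (highestWeightSpace_le_weightSpace _ _ hv)
    rwa [hsize, neg_neg, Int.toNat_natCast, Nat.mul_div_cancel_left _ (Nat.pos_of_ne_zero hm)] at h
  set v' : orbitCoordRingDeg f m d := ⟨v, hvd⟩ with hv'def
  have hv'0 : v' ≠ 0 := fun h => hv0 (congrArg Subtype.val h)
  have hv' : v' ∈ highestWeightSpace (orbitCoordRepDeg f m d) χ :=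
    (mem_highestWeightSpace_toRepresentation_iff (orbitCoordSubrep f m d) χ v').mpr hv
  -- an intertwiner `W → k[Δ_m[f]]_d` hitting `v' ≠ 0`
  obtain ⟨F, hF⟩ := exists_intertwiningMap_apply_eq hWrat hw hw0 hfrat hv' hv'0
  rw [hψ F] at hF
  exact hv'0 hF.symm

end Bridge

/-! ### BIP Thm. 1.4 in module form, unconditionally -/

/-- Renaming along `toLex` does not change the occurrence-obstruction predicate: the matrix
variables `Fin m × Fin m` and their lexicographically ordered copy `MatIdx m` carry the same
`GL`, the same coordinate rings and the same gradings (`Lex` is a type synonym and `toLex` the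
identity). [folklore] -/
theorem hasOccurrenceObstruction_rename_toLex_iff {m : ℕ} (f g : MvPolynomial (Fin m × Fin m) ℂ)
    (M d : ℕ) :
    HasOccurrenceObstruction (σ := MatIdx m) (rename toLex f) (rename toLex g) M d ↔
      HasOccurrenceObstruction f g M d := by
  have hf : (rename toLex f : MvPolynomial (MatIdx m) ℂ) = f := rename_id_apply f
  have hg : (rename toLex g : MvPolynomial (MatIdx m) ℂ) = g := rename_id_apply g
  rw [hf, hg]
  exact Iff.rfl

/-- **Bürgisser–Ikenmeyer–Panova, J. AMS 32 (2019), Thm. 1.4, in module form — discharge of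
`bip2019_not_hasOccurrenceObstruction`.** "Let `n, d, m` be positive integers with `n ≥ m^25` and
`λ ⊢ nd`. If `λ` occurs in `ℂ[Z_{n,m}]`, then `λ` also occurs in `ℂ[Ω_n]`." In the tree's letters
and BIP's own padding (`bipPaddedPerPoly`, `X₀₀ ∈ per_n`): for `1 ≤ n`, `1 ≤ d`, `n ^ 25 ≤ m`, no
irreducible subrepresentation of `ℂ[Δ[X₀₀^{m-n} per_n]]_d` fails to map nontrivially to
`ℂ[Δ[det_m]]_d`. Assembly: the weight form `bip2019_no_occurrence_obstructions_holds`
(`OccurrenceObstructionsDischarge.lean`, BIP §6 on the proved Thm. 2.1, Lemma 2.2, Props. 2.3, 2.4,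
Thm. 2.5, Prop. 3.2, Thm. 4.9, Props. 5.6(2), 5.8(2), 6.1, Thm. 6.2, Prop. 6.3), the bridge
`not_hasOccurrenceObstruction_of_forall_hasHighestWeight`, and transport along `toLex`.
[cite: BurgisserIkenmeyerPanovaJAMS2019, Thm. 1.4] -/
theorem bip2019_not_hasOccurrenceObstruction_holds : bip2019_not_hasOccurrenceObstruction := by
  intro n m d _ hn _hd hnm
  have key : ¬ HasOccurrenceObstruction (σ := MatIdx m) (detFormLex ℂ m) (bipPaddedPerFormLex ℂ n m) m d :=
    not_hasOccurrenceObstruction_of_forall_hasHighestWeight (NeZero.ne m) d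
      fun χ hχ => bip2019_no_occurrence_obstructions_holds n m hn hnm χ hχ
  rwa [detFormLex, bipPaddedPerFormLex, hasOccurrenceObstruction_rename_toLex_iff] at key

end Literature.Computability.Complexity

end
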